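/-
Copyright (c) 2026. All rights reserved.
Released under Apache 2.0 license as described in the file LICENSE.
Authors: abc-iut cell, seat abc-iut-w5-d218 (gen 3).
-/
import Mathlib.GroupTheory.PGroup
import Mathlib.GroupTheory.Index
import Mathlib.Topology.Algebra.ClopenNhdofOne
import Mathlib.Topology.Algebra.OpenSubgroup
import Mathlib.Topology.Algebra.Group.ClosedSubgroup

/-!
# Power maps in pro-`p` groups and the abstract finite quotients of a pro-`p` group

Classical facts about pro-`p` groups (J.-P. Serre, *Galois Cohomology*, I §1.4 and I §4.2 exercise 6;
J. D. Dixon, M. du Sautoy, A. Mann, D. Segal, *Analytic pro-`p` groups* (2nd ed.), §1.2–§1.3), in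
Mathlib-only vocabulary.  A *profinite* group is a compact, totally disconnected topological group; it
is *pro-`p`* when every quotient by an open normal subgroup is a `p`-group, i.e.
`∀ U : OpenNormalSubgroup G, IsPGroup p (G ⧸ (U : Subgroup G))` (equivalently: for every `g` the
powers `g ^ p ^ k` tend to `1`).  No definition is introduced: the pro-`p` hypothesis is spelled out.

* `eq_one_of_forall_openNormalSubgroup_mem` — an element of every open normal subgroup is `1`;
* `isPGroup_quotient_openNormalSubgroup_of_forall_nhds` / `forall_nhds_pow_mem_of_isPGroup_quotient` —
  the two phrasings of "pro-`p`" agree; `isPGroup_quotient_openNormalSubgroup_subgroup` — open (indeed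
  arbitrary) subgroups of pro-`p` groups are pro-`p`; `isPGroup_quotient_openNormalSubgroup_of_index` —
  the index phrasing (every open normal subgroup has `p`-power index) implies it;
* `pow_bijective_of_proP` — for `q` prime to `p`, `x ↦ x ^ q` is a BIJECTION of a pro-`p` group
  (DdSMS §1.2; Serre I §1.4: a pro-`p` group is a `ℤ_p`-"module", `q ∈ ℤ_p^×`);
* `isPGroup_quotient_of_finiteIndex_of_proP` — hence for every ABSTRACT normal subgroup `N` of finite
  index (no openness assumed) the finite group `G ⧸ N` is a `p`-group: every element of `G ⧸ N` is a
  `q`-th power for every prime `q ≠ p`, so `G ⧸ N` has no element of order `q` (first step of Serre's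
  theorem that finite-index subgroups of topologically finitely generated pro-`p` groups are open,
  DdSMS Thm 1.17; file `ProPStronglyComplete.lean`).

[cite: SerreGaloisCohomology1997, I §4.2 Exercise 6] [cite: DDMSAnalyticProP1999, §1.2–§1.3, Thm 1.17]
-/

namespace Literature.GroupTheory

open scoped Pointwise

section Profinite

variable {G : Type*} [Group G] [TopologicalSpace G] [IsTopologicalGroup G] [CompactSpace G]
  [TotallyDisconnectedSpace G]

omit [IsTopologicalGroup G] [CompactSpace G] [TotallyDisconnectedSpace G] in
/-- The whole group as an open normal subgroup (so that `OpenNormalSubgroup G` is nonempty).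
[cite: DDMSAnalyticProP1999, §1.2] -/
theorem nonempty_openNormalSubgroup : Nonempty (OpenNormalSubgroup G) :=
  ⟨{ toOpenSubgroup := ⊤, isNormal' := by
      change (⊤ : Subgroup G).Normal
      infer_instance }⟩

/-- In a profinite group an element lying in every open normal subgroup is trivial (the open normal
subgroups form a neighbourhood basis of `1` in a compact totally disconnected group).
[cite: DDMSAnalyticProP1999, §1.2] -/
theorem eq_one_of_forall_openNormalSubgroup_mem {g : G} (h : ∀ U : OpenNormalSubgroup G, g ∈ U) :
    g = 1 := by
  by_contra hg
  obtain ⟨N, hN⟩ := ProfiniteGrp.exist_openNormalSubgroup_sub_open_nhds_of_one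
    (isOpen_compl_singleton (x := g)) (by simpa using (Ne.symm hg))
  exact hN (h N) (Set.mem_singleton g)

/-- Two elements of a profinite group are equal as soon as they agree modulo every open normal
subgroup. [cite: DDMSAnalyticProP1999, §1.2] -/
theorem eq_of_forall_quotientMk_eq {x y : G}
    (h : ∀ U : OpenNormalSubgroup G,
      (QuotientGroup.mk x : G ⧸ (U : Subgroup G)) = QuotientGroup.mk y) : x = y := by
  have hxy : x⁻¹ * y = 1 :=
    eq_one_of_forall_openNormalSubgroup_mem fun U => QuotientGroup.eq.mp (h U)
  exact inv_mul_eq_one.mp hxy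

/-- A closed subset `C` of a profinite group is the intersection of its thickenings `C * U` by the open
normal subgroups `U`: if `g ∈ C * U` for every `U`, then `g ∈ C`. [cite: DDMSAnalyticProP1999, §1.2] -/
theorem mem_of_forall_mem_mul_openNormalSubgroup {C : Set G} (hC : IsClosed C) {g : G}
    (h : ∀ U : OpenNormalSubgroup G, g ∈ C * (U : Set G)) : g ∈ C := by
  by_contra hg
  -- the open neighbourhood `(g⁻¹ • C)ᶜ` of `1` contains an open normal subgroup `N`
  have hopen : IsOpen ((g⁻¹ • C)ᶜ : Set G) := (hC.smul g⁻¹).isOpen_compl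
  have hone : (1 : G) ∈ (g⁻¹ • C)ᶜ := by
    intro h1
    rw [Set.mem_smul_set_iff_inv_smul_mem, inv_inv, smul_eq_mul, mul_one] at h1
    exact hg h1
  obtain ⟨N, hN⟩ := ProfiniteGrp.exist_openNormalSubgroup_sub_open_nhds_of_one hopen hone
  obtain ⟨c, hc, u, hu, hcu⟩ := Set.mem_mul.mp (h N)
  -- then `c⁻¹ * g = u ∈ N`, so `u⁻¹ = g⁻¹ * c ∈ N ∩ g⁻¹ • C`, contradiction
  have hu' : u⁻¹ ∈ (N : Set G) := inv_mem hu
  have hmem : u⁻¹ ∈ g⁻¹ • C := by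
    rw [Set.mem_smul_set_iff_inv_smul_mem, inv_inv, smul_eq_mul]
    have : g * u⁻¹ = c := by rw [← hcu, mul_inv_cancel_right]
    rw [this]; exact hc
  exact hN hu' hmem

end Profinite

section ProP

variable {G : Type*} [Group G] [TopologicalSpace G] [IsTopologicalGroup G] [CompactSpace G]
  [TotallyDisconnectedSpace G] {p : ℕ}

/-- Pro-`p`, quotient phrasing ⇒ neighbourhood phrasing: in a pro-`p` group, for every `g` and every
neighbourhood `U` of `1`, some power `g ^ p ^ k` lies in `U`. [cite: DDMSAnalyticProP1999, §1.2] -/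
theorem forall_nhds_pow_mem_of_isPGroup_quotient
    (hP : ∀ U : OpenNormalSubgroup G, IsPGroup p (G ⧸ (U : Subgroup G)))
    (g : G) {U : Set G} (hU : U ∈ nhds (1 : G)) : ∃ k : ℕ, g ^ p ^ k ∈ U := by
  obtain ⟨N, hN⟩ := ProfiniteGrp.exist_openNormalSubgroup_sub_open_nhds_of_one
    isOpen_interior (mem_interior_iff_mem_nhds.mpr hU)
  obtain ⟨k, hk⟩ := hP N (QuotientGroup.mk g)
  refine ⟨k, interior_subset (hN ?_)⟩
  rw [← QuotientGroup.mk_pow, QuotientGroup.eq_one_iff] at hk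
  exact hk

/-- Neighbourhood phrasing ⇒ quotient phrasing, for an ARBITRARY topological group: if for every `g`
and every neighbourhood `U` of `1` some `g ^ p ^ k ∈ U`, then every quotient by an open normal
subgroup is a `p`-group. [cite: DDMSAnalyticProP1999, §1.2] -/
theorem isPGroup_quotient_openNormalSubgroup_of_forall_nhds {H : Type*} [Group H]
    [TopologicalSpace H] (hP : ∀ (g : H) (U : Set H), U ∈ nhds (1 : H) → ∃ k : ℕ, g ^ p ^ k ∈ U)
    (U : OpenNormalSubgroup H) : IsPGroup p (H ⧸ (U : Subgroup H)) := by
  intro x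
  induction x using QuotientGroup.induction_on with
  | H g =>
    obtain ⟨k, hk⟩ := hP g U (U.isOpen.mem_nhds (one_mem U))
    exact ⟨k, by rw [← QuotientGroup.mk_pow, QuotientGroup.eq_one_iff]; exact hk⟩

/-- Subgroups of pro-`p` groups are pro-`p` (for the subspace topology): every quotient of a subgroup
`H` by an open normal subgroup of `H` is a `p`-group. [cite: DDMSAnalyticProP1999, §1.2] -/
theorem isPGroup_quotient_openNormalSubgroup_subgroup
    (hP : ∀ U : OpenNormalSubgroup G, IsPGroup p (G ⧸ (U : Subgroup G))) (H : Subgroup G)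
    (V : OpenNormalSubgroup H) : IsPGroup p (H ⧸ (V : Subgroup H)) := by
  refine isPGroup_quotient_openNormalSubgroup_of_forall_nhds (fun h W hW => ?_) V
  -- a neighbourhood of `1` in `H` contains the trace of a neighbourhood of `1` in `G`
  obtain ⟨W', hW', hWW'⟩ : ∃ W' : Set G, W' ∈ nhds (1 : G) ∧ Subtype.val ⁻¹' W' ⊆ W := by
    rw [nhds_subtype_eq_comap] at hW
    obtain ⟨W', hW', h⟩ := hW
    exact ⟨W', hW', h⟩
  obtain ⟨k, hk⟩ := forall_nhds_pow_mem_of_isPGroup_quotient hP (h : G) hW'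
  refine ⟨k, hWW' ?_⟩
  show ((h ^ p ^ k : H) : G) ∈ W'
  rwa [Subgroup.coe_pow]

omit [IsTopologicalGroup G] [CompactSpace G] [TotallyDisconnectedSpace G] in
/-- Index phrasing ⇒ quotient phrasing: if every open normal subgroup of the profinite group `G` has
index a power of `p`, then `G` is pro-`p`. [cite: DDMSAnalyticProP1999, §1.2] -/
theorem isPGroup_quotient_openNormalSubgroup_of_index
    (hI : ∀ U : OpenNormalSubgroup G, ∃ n : ℕ, (U : Subgroup G).index = p ^ n)
    (U : OpenNormalSubgroup G) : IsPGroup p (G ⧸ (U : Subgroup G)) := by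
  obtain ⟨n, hn⟩ := hI U
  exact IsPGroup.of_card (by rw [← Subgroup.index_eq_card, hn])

omit [TotallyDisconnectedSpace G] in
/-- Index phrasing from the "only prime divisor of the index is `p`" phrasing (the form of the cell's
`IsProSet G {p}`): an open normal subgroup of a compact group has finite index, and a positive natural
number whose only prime divisor is `p` is a power of `p`. [cite: DDMSAnalyticProP1999, §1.2] -/
theorem exists_index_eq_pow_of_prime_dvd (U : OpenNormalSubgroup G)
    (h : ∀ q : ℕ, q.Prime → q ∣ (U : Subgroup G).index → q = p) :
    ∃ n : ℕ, (U : Subgroup G).index = p ^ n := by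
  haveI : Finite (G ⧸ (U : Subgroup G)) :=
    Subgroup.quotient_finite_of_isOpen (U : Subgroup G) U.isOpen
  have hne : (U : Subgroup G).index ≠ 0 := Subgroup.index_ne_zero_of_finite
  exact ⟨_, Nat.eq_prime_pow_of_unique_prime_dvd hne fun hd hdvd => h _ hd hdvd⟩

/-- **The `q`-power map of a pro-`p` group is injective** for `q` prime to `p`: if `x ^ q = y ^ q` then
`x ≡ y` modulo every open normal subgroup `U` (the finite `p`-group `G ⧸ U` has bijective `q`-power map,
`IsPGroup.powEquiv`), hence `x = y`. [cite: DDMSAnalyticProP1999, §1.2] -/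
theorem pow_injective_of_proP
    (hP : ∀ U : OpenNormalSubgroup G, IsPGroup p (G ⧸ (U : Subgroup G))) {q : ℕ}
    (hq : p.Coprime q) : Function.Injective fun x : G => x ^ q := by
  intro x y hxy
  dsimp only at hxy
  refine eq_of_forall_quotientMk_eq fun U => ((hP U).powEquiv hq).injective ?_
  simp only [IsPGroup.powEquiv_apply, ← QuotientGroup.mk_pow, hxy]

/-- **The `q`-power map of a pro-`p` group is surjective** for `q` prime to `p`: the sets
`{y | y ^ q ≡ x mod U}` over the open normal subgroups `U` are closed, nonempty (bijectivity of the
`q`-power map of the finite `p`-group `G ⧸ U`) and directed, so by compactness they have a common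
point `y`, and `y ^ q = x`. [cite: DDMSAnalyticProP1999, §1.2] -/
theorem pow_surjective_of_proP
    (hP : ∀ U : OpenNormalSubgroup G, IsPGroup p (G ⧸ (U : Subgroup G))) {q : ℕ}
    (hq : p.Coprime q) : Function.Surjective fun x : G => x ^ q := by
  intro x
  haveI : Nonempty (OpenNormalSubgroup G) := nonempty_openNormalSubgroup
  let S : OpenNormalSubgroup G → Set G := fun U => {y | y ^ q * x⁻¹ ∈ (U : Set G)}
  have hSc : ∀ U, IsClosed (S U) := fun U =>
    (U.toOpenSubgroup.isClosed).preimage ((continuous_pow q).mul continuous_const)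
  have hSne : ∀ U, (S U).Nonempty := fun U => by
    obtain ⟨z, hz⟩ := ((hP U).powEquiv hq).surjective (QuotientGroup.mk x)
    induction z using QuotientGroup.induction_on with
    | H y =>
      refine ⟨y, ?_⟩
      rw [IsPGroup.powEquiv_apply, ← QuotientGroup.mk_pow, QuotientGroup.eq_iff_div_mem,
        div_eq_mul_inv] at hz
      exact hz
  have hdir : Directed (· ⊇ ·) S := fun U V =>
    ⟨U ⊓ V, fun y (hy : _ ∈ _) => (show ((U ⊓ V : OpenNormalSubgroup G) : Set G) ⊆ U from
      fun _ h => h.1) hy,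
      fun y (hy : _ ∈ _) => (show ((U ⊓ V : OpenNormalSubgroup G) : Set G) ⊆ V from
      fun _ h => h.2) hy⟩
  obtain ⟨y, hy⟩ := IsCompact.nonempty_iInter_of_directed_nonempty_isCompact_isClosed S hdir hSne
    (fun U => (hSc U).isCompact) hSc
  refine ⟨y, ?_⟩
  have h1 : y ^ q * x⁻¹ = 1 :=
    eq_one_of_forall_openNormalSubgroup_mem fun U => Set.mem_iInter.mp hy U
  exact mul_inv_eq_one.mp h1

/-- The `q`-power map of a pro-`p` group is a bijection for `q` prime to `p` (DdSMS §1.2; Serre,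
*Galois Cohomology* I §1.4). [cite: DDMSAnalyticProP1999, §1.2] -/
theorem pow_bijective_of_proP
    (hP : ∀ U : OpenNormalSubgroup G, IsPGroup p (G ⧸ (U : Subgroup G))) {q : ℕ}
    (hq : p.Coprime q) : Function.Bijective fun x : G => x ^ q :=
  ⟨pow_injective_of_proP hP hq, pow_surjective_of_proP hP hq⟩

/-- **Abstract finite quotients of a pro-`p` group are `p`-groups.** If `N` is ANY normal subgroup of
finite index of a pro-`p` group `G` (openness NOT assumed), then `G ⧸ N` is a `p`-group: for a prime
`q ≠ p` every element of `G ⧸ N` is a `q`-th power (`pow_surjective_of_proP`), so the `q`-power map of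
the finite group `G ⧸ N` is surjective, hence injective, which excludes elements of order `q`.  First
step of Serre's theorem (DdSMS Thm 1.17). [cite: DDMSAnalyticProP1999, Thm 1.17] -/
theorem isPGroup_quotient_of_finiteIndex_of_proP [hp : Fact p.Prime]
    (hP : ∀ U : OpenNormalSubgroup G, IsPGroup p (G ⧸ (U : Subgroup G)))
    (N : Subgroup G) [N.Normal] [N.FiniteIndex] : IsPGroup p (G ⧸ N) := by
  classical
  haveI : Finite (G ⧸ N) := Subgroup.finite_quotient_of_finiteIndex
  -- every prime factor of the order of `G ⧸ N` is `p`
  rw [IsPGroup.iff_card]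
  have hcard : Nat.card (G ⧸ N) ≠ 0 := Nat.card_pos.ne'
  have key : ∀ q : ℕ, q.Prime → q ∣ Nat.card (G ⧸ N) → q = p := by
    intro q hq hqd
    by_contra hqp
    haveI : Fact q.Prime := ⟨hq⟩
    -- an element of order `q`
    obtain ⟨g, hg⟩ := exists_prime_orderOf_dvd_card' (G := G ⧸ N) q hqd
    -- the `q`-power map of `G ⧸ N` is surjective, hence injective
    have hsurj : Function.Surjective fun z : G ⧸ N => z ^ q := by
      intro z
      induction z using QuotientGroup.induction_on with
      | H x =>
        obtain ⟨y, hy⟩ := pow_surjective_of_proP hP ((Nat.coprime_primes hp.out hq).mpr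
          (Ne.symm hqp)) x
        exact ⟨QuotientGroup.mk y, by dsimp only at hy ⊢; rw [← QuotientGroup.mk_pow, hy]⟩
    have hinj : Function.Injective fun z : G ⧸ N => z ^ q :=
      Finite.injective_iff_surjective.mpr hsurj
    have hg1 : g ^ q = 1 := by rw [← hg, pow_orderOf_eq_one]
    have : g = 1 := hinj (by dsimp only; rw [hg1, one_pow])
    rw [this, orderOf_one] at hg
    exact hq.one_lt.ne' hg.symm |>.elim
  exact ⟨_, Nat.eq_prime_pow_of_unique_prime_dvd hcard fun hd hdvd => key _ hd hdvd⟩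

end ProP

end Literature.GroupTheory
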